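import Summits.ResolutionOfSingularities.ResolutionOfSingularities.Theorems.UniformComplexityCampaignW82TwistExponentRigidity
import Summits.ResolutionOfSingularities.ResolutionOfSingularities.Theorems.UniformComplexityCampaignW82TwistExponentBaseChange
import Summits.ResolutionOfSingularities.ResolutionOfSingularities.Theorems.UniversalCellsCampaignW82FrobeniusTwistRungs
import Mathlib.FieldTheory.RatFunc.Degree
import Mathlib.FieldTheory.PurelyInseparable.PerfectClosure
import HarnessLib

/-!
# [OURS · L1 W8.2] No bounded Frobenius-twist exponent: the `∃ e` of the W8.2 residual is unbounded already for curves

Cell `res-hironaka` (run/shared/lean/pub/res-hironaka/), LADDER-RESOLUTION rung L (RESCUE), slot W8.2 of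
plan/RESCUE-SEED.md («PRIME-FIELD / UNIVERSALITY TRANSFER instead of descent»), door 2 = route
`UniformComplexity`, host item `PrimeModelTransfer` (stmt-ResolutionOfSingularities-8933); prover
res-L1-s82-pv-2 (gen 3). THESES-FREE module (imports the sibling `…TwistExponentRigidity`, the OURS
vocabulary/rung files `…CampaignW82FrobeniusTwistRungs` (p483971/p484563: `HasSmoothFrobeniusTwistModel`,
`IntegralOverPerfectClosure`, `hasSmoothFrobeniusTwistModel_of_dim_le_one`, `exists_smoothModel_baseChange`),
Mathlib, `HarnessLib`).

[OURS · L1 W8.2] replaces the role of no printed item; NOT a statement of H. Hironaka's manuscript. NEGATIVE RUNG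
on the Frobenius-twist normal form of the slot's residual (`CampaignW82.FrobeniusTwistStepRegularAt p M n`:
«… some Frobenius twist `X₀ ×_{K,Frob^e} K` has a proper birational model SMOOTH over `K = M(t)`»; TFAE with the
perfection / smooth-twist steps, `residual_normalForms_tfae` p486090):

* `frobeniusTwist_exponent_unbounded p M e₀`: for EVERY prime `p`, EVERY constant field `M` of characteristic
  `p` (in particular algebraically closed `M` — door 2) and every `e₀`, the curve `X₀ : y^q = x^{p^{e₀+1}} − t`
  over `M(t)` (`q` a prime `≠ p`) is separated of finite type of dimension `≤ 1`, integral over the perfect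
  closure, HAS a smooth proper birational model of some Frobenius twist (the curve rung, unconditional) — and
  NO twist of level `e ≤ e₀` has one;
* `not_exists_uniform_frobeniusTwist_exponent p M`: hence the bounded-exponent strengthening «`∃ e ≤ E`» of the
  Frobenius-twist step at grade `n = 1` is FALSE for every `E`.

Mechanism (all proved here and in the siblings): the `e`-th twist of `X₀` is `y^q = (x^{p^{e₀+1−e}} − t)^{p^e}`;
a smooth model at level `e ≤ e₀` base-changes to one at level `e₀` (`exists_smoothModel_baseChange` along
`Frob^{e₀−e}`), i.e. of `C_{p^{e₀}} : y^q = (x^p − t)^{p^{e₀}}` (`pullbackTwistCurveIso`,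
`twistPoly_pow_succ_frob`), which has none (`no_smooth_model_twistCurve`: its normalisation is Kollár's
regular non-smooth curve `w^q = x^p − t`). So in the residual the level `e` must depend on `X₀` (not only on
`p` and `dim X₀`): mechanisms of the shape «twist a bounded number of times, then normalise / resolve once»
cannot prove the perfection step; this matches the genus-change picture (Tate 1952: the genus drops stepwise
along `K ⊂ K^{1/p} ⊂ …`, with no bound on the number of steps uniform in the curve) and complements
res-L1-s82-pv-1's «exponent `e = 0` is insufficient» (`N = 1`). Door-2 reading: the constant field `M` is
arbitrary, so algebraic closedness of `M` (Cruxes/…/DOOR2-KERNEL.md §3) does not bound `e` either.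

Also here: `twistPoly_pow_succ_frob` / `twistPoly_pow_perf` (the polynomial identities behind the twists),
`twistCurveIsoOfEq`, `irreducible_X_pow_sub_C_ratFuncX` (`t ∉ M(t)^p`), `integralOverPerfectClosure_twistCurve`,
`no_smooth_model_frobeniusTwist_of_le`.

HONEST FRAMING. OURS bookkeeping about an OURS statement; NOT a statement of H. Hironaka's 2017 manuscript
([Hironaka2017]); nothing is attributed to its author. It says nothing about the open grades `n ≥ 4` beyond
«`e` is not uniform»; AI work, weaker than expert review.

## References (vocabulary and locators only)
* J. Kollár, *Lectures on Resolution of Singularities* (2007), 1.19. [Kollar2007]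
* J. Tate, *Genus change in inseparable extensions of function fields*, Proc. AMS 3 (1952) 400–406 — the
  phenomenon; not used formally. S. Schröer, arXiv:math/0703122, §1 — same.
* Cruxes/PrimeFieldToPerfect/KERNEL-c3.md §1 (1c); L/res-L1-s82-pv-2/NOTES.md (gen 3).
-/

noncomputable section

set_option linter.dupNamespace false -- mandated namespace of this single-conjunct summit

open Polynomial
open scoped TensorProduct
open _root_.CategoryTheory _root_.CategoryTheory.Limits _root_.AlgebraicGeometry

namespace Summit.ResolutionOfSingularities.ResolutionOfSingularities.Theorems.CampaignW82.TwistExponent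

open Literature.AlgebraicGeometry.Resolution

/-! ## §10 Polynomial identities: Frobenius twists and perfect base change of `y^q = x^{p^m} − t` -/

section Identities

variable (K : Type) [Field K] (p : ℕ) [hp : Fact p.Prime] [CharP K p] (t : K) (q : ℕ)

/-- **The `e`-th Frobenius twist of `y^q = x^{p^{e+1}} − t` is `C_{p^e}`**: in characteristic `p`,
`X₀^q − (X₁^{p^{e+1}} − t^{p^e}) = X₀^q − (X₁^p − t)^{p^e}`. [folklore] -/
theorem twistPoly_pow_succ_frob (e : ℕ) :
    twistPoly K (p ^ (e + 1)) (t ^ p ^ e) q 1 = twistPoly K p t q (p ^ e) := by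
  simp only [twistPoly, pow_one]
  rw [sub_pow_char_pow, ← pow_mul, ← pow_succ', map_pow]

/-- **Over a field containing `τ = t^{1/p^m}`, `y^q = x^{p^m} − t` is `y^q = (x − τ)^{p^m}`**:
`X₀^q − (X₁^{p^m} − τ^{p^m}) = X₀^q − (X₁^1 − τ)^{p^m}`. [folklore] -/
theorem twistPoly_pow_perf {L : Type} [Field L] [CharP L p] (τ : L) (m : ℕ) :
    twistPoly L (p ^ m) (τ ^ p ^ m) q 1 = twistPoly L 1 τ q (p ^ m) := by
  simp only [twistPoly, pow_one]
  rw [sub_pow_char_pow, map_pow]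

/-- Equal defining polynomials give isomorphic curves over `K` (`Ideal.quotEquivOfEq`). [folklore] -/
def twistCurveIsoOfEq {P P' N N' : ℕ} {t t' : K} (h : twistPoly K P t q N = twistPoly K P' t' q N') :
    twistCurve K P t q N ≅ twistCurve K P' t' q N' :=
  Scheme.Spec.mapIso
    ((Ideal.quotEquivOfEq (by rw [h]) :
      TwistRing K P' t' q N' ≃+* TwistRing K P t q N).toCommRingCatIso).op

omit hp [CharP K p] in
/-- `twistCurveIsoOfEq` lies over `Spec K`. [folklore] -/
theorem twistCurveIsoOfEq_hom_comp {P P' N N' : ℕ} {t t' : K}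
    (h : twistPoly K P t q N = twistPoly K P' t' q N') :
    (twistCurveIsoOfEq K q h).hom ≫ twistCurveTo K P' t' q N' = twistCurveTo K P t q N := by
  change Spec.map _ ≫ Spec.map _ = Spec.map _
  rw [← Spec.map_comp]
  congr 1

end Identities

/-! ## §11 The witness `X₀ : y^q = x^{p^{e₀+1}} − t` over `K = M(t)` -/

section Witness

/-- An auxiliary prime different from `p`: `3` if `p = 2`, else `2`. [folklore] -/
def altPrime (p : ℕ) : ℕ := if p = 2 then 3 else 2

/-- `altPrime p` is prime. [folklore] -/
theorem altPrime_prime (p : ℕ) : (altPrime p).Prime := by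
  unfold altPrime; split_ifs <;> norm_num

/-- `altPrime p ≠ p`. [folklore] -/
theorem altPrime_ne {p : ℕ} (hp : p.Prime) : altPrime p ≠ p := by
  unfold altPrime; split_ifs with h
  · omega
  · intro h2; exact h (by have := hp.two_le; omega)

/-- `altPrime p ∤ p^n`. [folklore] -/
theorem not_altPrime_dvd {p : ℕ} (hp : p.Prime) (n : ℕ) : ¬ altPrime p ∣ p ^ n := fun h =>
  altPrime_ne hp ((Nat.prime_dvd_prime_iff_eq (altPrime_prime p) hp).mp ((altPrime_prime p).dvd_of_dvd_pow h))

/-- `intDegree (x^n) = n · intDegree x` in `M(t)`. [folklore] -/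
theorem RatFunc.intDegree_pow' {M : Type} [Field M] {x : RatFunc M} (hx : x ≠ 0) (n : ℕ) :
    (x ^ n).intDegree = n * x.intDegree := by
  induction n with
  | zero => simp
  | succ n ih => rw [pow_succ, RatFunc.intDegree_mul (pow_ne_zero n hx) hx, ih]; push_cast; ring

/-- **`X^p − t` is irreducible over `K = M(t)`** (`t = RatFunc.X` is not a `p`-th power: degrees).
[folklore] -/
theorem irreducible_X_pow_sub_C_ratFuncX (p : ℕ) [hp : Fact p.Prime] (M : Type) [Field M] :
    Irreducible (X ^ p - C (RatFunc.X : RatFunc M)) := by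
  refine (X_pow_sub_C_irreducible_iff_of_prime hp.out).mpr fun b hb => ?_
  have hb0 : b ≠ 0 := by
    rintro rfl
    rw [zero_pow hp.out.ne_zero] at hb
    exact RatFunc.X_ne_zero hb.symm
  have h := congrArg RatFunc.intDegree hb
  rw [RatFunc.intDegree_pow' hb0, RatFunc.intDegree_X] at h
  have h2 : (p : ℤ) ∣ 1 := ⟨b.intDegree, by linarith⟩
  have : (p : ℤ) ≤ 1 := Int.le_of_dvd one_pos h2
  have := hp.out.two_le
  omega

variable (K : Type) [Field K] (p : ℕ) [hp : Fact p.Prime] [CharP K p] (t : K) (q : ℕ) [hq : Fact q.Prime]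

/-- **`y^q = x^{p^m} − t` is integral over the perfect closure** (`q ≠ p`): over
`L = K^{perf} ⊆ K̄` with `τ^{p^m} = t` it becomes `y^q = (x − τ)^{p^m}`, a prime binomial
(`prime_twistPoly'` with base exponent `1`). [folklore] -/
theorem integralOverPerfectClosure_twistCurve (hqp : q ≠ p) (m : ℕ) :
    IntegralOverPerfectClosure K (twistCurveTo K (p ^ m) t q 1) := by
  let E := AlgebraicClosure K
  let L : IntermediateField K E := perfectClosure K E
  haveI : CharP E p := charP_of_injective_algebraMap (algebraMap K E).injective p
  haveI : CharP L p := charP_of_injective_algebraMap (algebraMap K L).injective p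
  haveI : ExpChar K p := ExpChar.prime hp.out
  obtain ⟨σ, hσ⟩ : ∃ σ : E, σ ^ p ^ m = algebraMap K E t :=
    IsAlgClosed.exists_pow_nat_eq _ (pow_pos hp.out.pos m)
  have hσL : σ ∈ L := (mem_perfectClosure_iff_pow_mem p).mpr ⟨m, ⟨t, hσ.symm⟩⟩
  let τ : L := ⟨σ, hσL⟩
  have hτ : τ ^ p ^ m = algebraMap K L t := Subtype.ext hσ
  refine ⟨L, inferInstance, inferInstance, inferInstance, inferInstance, ?_⟩
  -- `X₀ ×_K L ≅ C(L)`, a `Spec` of a domain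
  have hq1 : ¬ q ∣ 1 := fun h => hq.out.ne_one (Nat.dvd_one.mp h)
  have hqpm : ¬ q ∣ p ^ m := fun h =>
    hqp ((Nat.prime_dvd_prime_iff_eq hq.out hp.out).mp (hq.out.dvd_of_dvd_pow h))
  haveI : IsDomain (TwistRing L 1 τ q (p ^ m)) := isDomain_twistRing' Nat.one_pos hq1 hqpm
  have heq : twistPoly L (p ^ m) (algebraMap K L t) q 1 = twistPoly L 1 τ q (p ^ m) := by
    rw [← hτ]; exact twistPoly_pow_perf p q τ m
  haveI : IsDomain (TwistRing L (p ^ m) (algebraMap K L t) q 1) :=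
    MulEquiv.isDomain (TwistRing L 1 τ q (p ^ m))
      (Ideal.quotEquivOfEq (by rw [heq]) : TwistRing L (p ^ m) (algebraMap K L t) q 1 ≃+*
        TwistRing L 1 τ q (p ^ m)).toMulEquiv
  haveI : IsIntegral (twistCurve L (p ^ m) (algebraMap K L t) q 1) := inferInstance
  exact IsIntegral.of_isIso (pullbackTwistCurveIso K (p ^ m) t q (algebraMap K (L : Type))).inv

end Witness

/-! ## §12 The rung: no bound on the Frobenius-twist exponent -/

section Main

variable (p : ℕ) [hp : Fact p.Prime] (M : Type) [Field M] [CharP M p]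

/-- **No level `e ≤ e₀` smooths `X₀ : y^q = x^{p^{e₀+1}} − t` over `K = M(t)`**: a proper birational
model of the `e`-th Frobenius twist smooth over `K` would base-change (`exists_smoothModel_baseChange`,
along `Frob^{e₀−e}`) to one of the `e₀`-th twist, which is `C_{p^{e₀}} : y^q = (x^p − t)^{p^{e₀}}`
(`pullbackTwistCurveIso`, `twistPoly_pow_succ_frob`) and has none (`no_smooth_model_twistCurve`).
[folklore] -/
theorem no_smooth_model_frobeniusTwist_of_le (q : ℕ) [hq : Fact q.Prime] (hqp : q ≠ p) (e₀ e : ℕ)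
    (he : e ≤ e₀) (Y : Scheme.{0})
    (π : Y ⟶ pullback (twistCurveTo (RatFunc M) (p ^ (e₀ + 1)) RatFunc.X q 1)
      (Spec.map (CommRingCat.ofHom (iterateFrobenius (RatFunc M) p e))))
    [IsProper π] (hbir : IsBirational π)
    [Smooth (π ≫ pullback.snd (twistCurveTo (RatFunc M) (p ^ (e₀ + 1)) RatFunc.X q 1)
      (Spec.map (CommRingCat.ofHom (iterateFrobenius (RatFunc M) p e))))] : False := by
  haveI : LocallyOfFiniteType (twistCurveTo (RatFunc M) (p ^ (e₀ + 1)) RatFunc.X q 1) := by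
    rw [HasRingHomProperty.Spec_iff (P := @LocallyOfFiniteType), CommRingCat.hom_ofHom,
      RingHom.finiteType_algebraMap]
    infer_instance
  -- move to level `e₀`
  have hθ : (iterateFrobenius (RatFunc M) p (e₀ - e)).comp (iterateFrobenius (RatFunc M) p e) =
      iterateFrobenius (RatFunc M) p e₀ := by
    rw [← iterateFrobenius_add, Nat.sub_add_cancel he]
  obtain ⟨Y', ρ', hP', hB', hS'⟩ :=
    exists_smoothModel_baseChange (twistCurveTo (RatFunc M) (p ^ (e₀ + 1)) RatFunc.X q 1)
      (iterateFrobenius (RatFunc M) p e) (iterateFrobenius (RatFunc M) p (e₀ - e))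
      (iterateFrobenius (RatFunc M) p e₀) hθ Y π hbir
  haveI := hP'
  haveI := hS'
  -- identify the `e₀`-th twist with `C_{p^{e₀}}`
  let ε₁ := pullbackTwistCurveIso (RatFunc M) (p ^ (e₀ + 1)) (RatFunc.X : RatFunc M) q
    (iterateFrobenius (RatFunc M) p e₀)
  have hfrob : twistPoly (RatFunc M) (p ^ (e₀ + 1)) (iterateFrobenius (RatFunc M) p e₀ RatFunc.X) q 1 =
      twistPoly (RatFunc M) p RatFunc.X q (p ^ e₀) := by
    rw [iterateFrobenius_def]; exact twistPoly_pow_succ_frob (RatFunc M) p RatFunc.X q e₀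
  let ε₂ := twistCurveIsoOfEq (RatFunc M) q hfrob
  let π' : Y' ⟶ twistCurve (RatFunc M) p RatFunc.X q (p ^ e₀) := (ρ' ≫ ε₁.hom) ≫ ε₂.hom
  have hbir' : IsBirational π' := (hB'.comp_iso ε₁.hom).comp_iso ε₂.hom
  haveI : IsProper π' := inferInstance
  haveI : Smooth (π' ≫ twistCurveTo (RatFunc M) p RatFunc.X q (p ^ e₀)) := by
    have : π' ≫ twistCurveTo (RatFunc M) p RatFunc.X q (p ^ e₀) =
        ρ' ≫ pullback.snd (twistCurveTo (RatFunc M) (p ^ (e₀ + 1)) RatFunc.X q 1)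
          (Spec.map (CommRingCat.ofHom (iterateFrobenius (RatFunc M) p e₀))) := by
      simp only [π', Category.assoc]
      rw [twistCurveIsoOfEq_hom_comp, pullbackTwistCurveIso_hom_comp]
    rw [this]; exact hS'
  exact no_smooth_model_twistCurve (K := RatFunc M) (p := p) (t := RatFunc.X) (q := q) hqp
    (irreducible_X_pow_sub_C_ratFuncX p M) (pow_pos hp.out.pos e₀)
    ((Nat.coprime_primes hq.out hp.out).mpr hqp |>.pow_right e₀) Y' π' hbir'

/-- **[OURS · L1 W8.2] THE EXPONENT OF THE FROBENIUS-TWIST NORMAL FORM IS UNBOUNDED, already for curves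
over `M(t)` with ANY constant field `M` of characteristic `p`** (in particular algebraically closed `M`:
door 2). For every `e₀` there is a separated finite-type `f₀ : X₀ ⟶ Spec M(t)` of dimension `≤ 1`,
integral over the perfect closure — namely `X₀ : y^q = x^{p^{e₀+1}} − t` (`q` a prime `≠ p`) — which
HAS a smooth proper birational model of some Frobenius twist (`CampaignW82.HasSmoothFrobeniusTwistModel`,
here from the curve rung `hasSmoothFrobeniusTwistModel_of_dim_le_one`; concretely the level `e₀ + 1`
works), but NO level `e ≤ e₀` does: the `e`-th twist `y^q = (x^{p^{e₀+1−e}} − t)^{p^e}` has the regular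
non-smooth normalisation `w^q = x^{p^{e₀+1−e}} − t`. So in the residual of slot W8.2 the witness `e`
must depend on `X₀`, not only on `(p, dim X₀)`; mechanisms of the shape «twist a bounded number of
times, then normalise/resolve» cannot prove it. Replaces the role of no printed item; NOT a statement of
H. Hironaka's manuscript. [folklore] -/
theorem frobeniusTwist_exponent_unbounded (e₀ : ℕ) :
    ∃ (X₀ : Scheme.{0}) (f₀ : X₀ ⟶ Spec (.of (RatFunc M))),
      IsSeparated f₀ ∧ LocallyOfFiniteType f₀ ∧ QuasiCompact f₀ ∧ topologicalKrullDim X₀ ≤ 1 ∧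
      IntegralOverPerfectClosure (RatFunc M) f₀ ∧ HasSmoothFrobeniusTwistModel p (RatFunc M) f₀ ∧
      ∀ e ≤ e₀, ∀ (Y : Scheme.{0})
        (π : Y ⟶ pullback f₀ (Spec.map (CommRingCat.ofHom (iterateFrobenius (RatFunc M) p e)))),
        IsProper π → IsBirational π →
          ¬ Smooth (π ≫ pullback.snd f₀ (Spec.map (CommRingCat.ofHom (iterateFrobenius (RatFunc M) p e)))) := by
  let q := altPrime p
  haveI hq : Fact q.Prime := ⟨altPrime_prime p⟩
  have hqp : q ≠ p := altPrime_ne hp.out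
  let f₀ := twistCurveTo (RatFunc M) (p ^ (e₀ + 1)) RatFunc.X q 1
  haveI : LocallyOfFiniteType f₀ := by
    rw [HasRingHomProperty.Spec_iff (P := @LocallyOfFiniteType), CommRingCat.hom_ofHom,
      RingHom.finiteType_algebraMap]
    infer_instance
  have hd : topologicalKrullDim ↥(twistCurve (RatFunc M) (p ^ (e₀ + 1)) RatFunc.X q 1) ≤ 1 :=
    topologicalKrullDim_twistCurve_le_one
      (prime_twistPoly' (pow_pos hp.out.pos _) (not_altPrime_dvd hp.out _)
        (fun h => hq.out.ne_one (Nat.dvd_one.mp h))).ne_zero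
  have hint : IntegralOverPerfectClosure (RatFunc M) f₀ :=
    integralOverPerfectClosure_twistCurve (RatFunc M) p RatFunc.X q hqp (e₀ + 1)
  refine ⟨twistCurve (RatFunc M) (p ^ (e₀ + 1)) RatFunc.X q 1, f₀, inferInstance, inferInstance,
    inferInstance, hd, hint, hasSmoothFrobeniusTwistModel_of_dim_le_one p (RatFunc M) f₀ hd hint, ?_⟩
  intro e he Y π hP hB hS
  exact no_smooth_model_frobeniusTwist_of_le p M q hqp e₀ e he Y π hB

/-- **[OURS · L1 W8.2] Hence NO UNIFORM EXPONENT: the bounded-exponent strengthening of the Frobenius-twist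
step (`CampaignW82.FrobeniusTwistStepAt p M 1` with «`∃ e ≤ E`» in place of «`∃ e`») is FALSE for every
`E`, every prime `p` and every constant field `M` of characteristic `p`.** [folklore] -/
theorem not_exists_uniform_frobeniusTwist_exponent :
    ¬ ∃ E : ℕ, ∀ (X₀ : Scheme.{0}) (f₀ : X₀ ⟶ Spec (.of (RatFunc M))),
      IsSeparated f₀ → LocallyOfFiniteType f₀ → QuasiCompact f₀ → topologicalKrullDim X₀ ≤ 1 →
        IntegralOverPerfectClosure (RatFunc M) f₀ →
        ∃ e ≤ E, ∃ (Y : Scheme.{0})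
          (π : Y ⟶ pullback f₀ (Spec.map (CommRingCat.ofHom (iterateFrobenius (RatFunc M) p e)))),
          IsProper π ∧ IsBirational π ∧
            Smooth (π ≫ pullback.snd f₀ (Spec.map (CommRingCat.ofHom (iterateFrobenius (RatFunc M) p e)))) := by
  rintro ⟨E, hE⟩
  obtain ⟨X₀, f₀, hs, hl, hqc, hd, hint, -, hneg⟩ := frobeniusTwist_exponent_unbounded p M E
  obtain ⟨e, he, Y, π, hP, hB, hS⟩ := hE X₀ f₀ hs hl hqc hd hint
  exact hneg e he Y π hP hB hS

end Main

end Summit.ResolutionOfSingularities.ResolutionOfSingularities.Theorems.CampaignW82.TwistExponent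

end
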